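import Literature.NumberTheory.ComplexMultiplication.CMTypeRankAlternatingOverImaginaryQuadratic
import Literature.NumberTheory.ComplexMultiplication.PairKernelAlternatingQuotient
import Literature.AlgebraicGeometry.Pohlmann1968.CorankOneCMTypePowersHodgeConjecture
import HarnessLib

/-!
# Simple CM abelian varieties with CM by `K ⊇ k` (imaginary quadratic), `Gal(K₀ᶜ/ℚ) ⊇ Aₙ`: corank `≤ 1` always;
# the Hodge conjecture for all powers in ODD dimension (Dodson 1987 Prop. 2.1), the Weil-type dichotomy in even dimension

B. Dodson, *On the Mumford–Tate group of an abelian variety with complex multiplication*, J. Algebra **111** (1987)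
[Dodson1987] (held text `paper:doi-10-1016-0021-8693-87-90242-0`, pp. 58–59), **Prop. 2.1**: "Let `n` be odd and
suppose that `K` is a CM-field of degree `2n` such that the maximal totally real subfield `K₀` has `Gal(K₀ᶜ/ℚ) ≅ Aₙ`, or
`Sₙ`.  Then every primitive CM-type `(K, Φ)` is nondegenerate"; p. 50: "`Rank(Φ)` coincides with the dimension of the
Mumford–Tate group of Abelian varieties of type `(K, Φ)`" (Pohlmann); B. B. Gordon, *A survey of the Hodge conjecture for
abelian varieties* [Gordon1999HodgeAVSurvey], Thm. 6.4 (Hazama): "`Hdg(Aⁿ) = Div(Aⁿ)` for all `n` if and only if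
`dim Hg(A) = dim A`", §9.3: nondegenerate ⟹ the Hodge conjecture for all powers; 5.13 / 9.5: the Weil-type dichotomy.

For a CM field `K` containing an imaginary quadratic field `k` whose Galois closure `Kᶜ` has `n! ∣ [Kᶜ : ℚ]`
(`n = [K:ℚ]/2 ≥ 3`; equivalently `Gal(K₀ᶜ/ℚ) ≅ Aₙ` or `Sₙ`), the number-field files
`CMTypeRankAlternatingBlock` / `CMTypeRankAlternatingOverImaginaryQuadratic` computed the rank of EVERY primitive type:
`n + 1` (unbalanced over `k`) or exactly `n` (balanced over `k`, `n` even).  Consequences for the abelian varieties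
(every realisation `(A, ι, θ)` of a primitive type `(K; Φ)` = every simple CM abelian variety of type `(K, Φ)`):

* **`le_cmTypeRank_of_isPrimitive`** — corank `≤ 1` for EVERY primitive type of such a `K` (`dim MT(A) ≥ dim A`): the
  standing hypothesis `hrank` of the tree's `CorankOne*` files holds automatically, in every degree (there it was known
  in degrees `8` and `12` only: `CorankOne.le_cmTypeRank_of_finrank_eq_eight`, `CMSixfoldRank`);
* **`hodgeConjectureFor_pow_of_odd`**, `hodgeConjectureFor_of_odd`, `hodgeClassSpan_pow_eq_divisorClassesSpan_of_odd`
  — **`n` ODD: `Bᵐ(Aʳ) ⊗ ℂ = Dᵐ(Aʳ) ⊗ ℂ` and the Hodge conjecture for `A` and all its powers, UNCONDITIONALLY** (Prop.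
  2.1 + Hazama–Murty, the tree's `IsNondegenerate.hodgeConjectureFor_pow`) — a class of simple CM abelian varieties of
  every odd dimension `n ≥ 3` stated by a Galois-theoretic invariant of `K`;
* `hodgeConjectureFor_pow_of_two_mul_ne` — any `n`: the same for the types unbalanced over `k`;
  `not_isNondegenerate_of_two_mul_eq`, `exists_exceptional_pow_of_two_mul_eq` — balanced over `k` (`n` even): degenerate,
  with an exceptional Hodge class on some power (indeed a Weil class over `k` on `A` itself, by corank one);
* **`hodgeConjectureFor_pow_or_weilType`** — the dichotomy of Gordon 5.13 for ALL these varieties in every dimension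
  (`CorankOne.hodgeConjectureFor_pow_or_weilType` with `hrank` discharged): nondegenerate and HC for all powers, OR
  `(A, ι √-d)` is of Weil type and HC(`A`) follows from the algebraicity of the rational classes of its ONE Weil plane;
  **`hodgeConjectureFor_pow_of_weilClasses`** — HC for all powers modulo the Weil classes of `A`'s own Weil-type pairs
  (`CorankOne.hodgeConjectureFor_pow`); `hodgeConjectureFor_pow_of_weilClassesImaginaryQuadratic` — modulo the
  imaginary-quadratic rung of the Weil-type ladder in dimension `n = 2p`;
* the same over an explicit `k : k₀ →+* K` (`[k₀:ℚ] = 2`): `le_cmTypeRank_of_isPrimitive_of_ringHom`,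
  `hodgeConjectureFor_pow_of_ringHom_of_odd`, `hodgeConjectureFor_pow_or_weilType_of_ringHom`.
* **`hodgeConjectureFor_pow_of_factorial_dvd_finrank_normalClosure_of_odd`** (§4) — Prop. 2.1 AS PRINTED, read on
  the abelian varieties: `n = dim A ≥ 3` ODD and `Gal(K₀ᶜ/ℚ) ≅ Aₙ` or `Sₙ` (stated as `n!/2 ∣ [K₀ᶜ : ℚ]`,
  `K₀ᶜ = normalClosure ℚ K₀ L`) ⟹ the Hodge conjecture for `A` and all its powers, no hypothesis on an imaginary
  quadratic subfield (the companion file `PairKernelAlternatingQuotient` proves the dichotomy "one orbit of `2ⁿ` types,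
  or `K ⊇ k` imaginary quadratic" behind it).

KERNEL ONLY: theorems, no definition, no named fact (D-0014/D-0026).  `HC_CM` is neither used nor implied.

## References

* [Dodson1987] B. Dodson, J. Algebra 111 (1987), Prop. 2.1 (pp. 58–59), §1.1 (p. 50).
* [Gordon1999HodgeAVSurvey] B. B. Gordon, Thm. 6.4, §9.3–9.5, 5.13.
* [Dodson1984] B. Dodson, Trans. AMS 283 (1984), §3.1.1.
* [vanGeemen1994HodgeAV] B. van Geemen, LNM 1594, 4.7, Thm. 6.12 (through the `CorankOne` files).
-/

noncomputable section

open CategoryTheory NumberField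

namespace Literature.AlgebraicGeometry.Pohlmann1968

namespace AlternatingRealField

open Literature.NumberTheory.ComplexMultiplication
open Literature.AlgebraicGeometry.Motives (AbelianVariety CMType)
open Literature.AlgebraicGeometry.HodgeTheory
open Literature.AlgebraicGeometry.ComplexMultiplication (IsCMTypeRealisation)
open Literature.AlgebraicGeometry.VanGeemen1994 (hodgeClassSpan)
open Literature.Barriers.HodgeConjecture (divisorClassesSpan)

variable {K : Type} [Field K] [NumberField K] [IsCMField K]
variable {L : Type} [Field L] [NumberField L] [IsCMField L] [IsGalois ℚ L] [IsNormalClosure ℚ K L]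

/-! ### §1 Type level: corank `≤ 1` for every primitive type -/

section TypeLevel

omit [IsCMField K] in
/-- **Every primitive CM type of `K ⊇ k` with `n! ∣ [Kᶜ : ℚ]` (`n ≥ 3`) has corank `≤ 1`: `n ≤ Rank(Φ)`**
(`= n + 1` if unbalanced over `k`, `= n` if balanced).  This is the hypothesis `hrank` of the tree's `CorankOne` files.
[cite: Dodson1987, Prop. 2.1 (proof)] [cite: Dodson1984, §3.1.1 Theorem] -/
theorem le_cmTypeRank_of_isPrimitive (j : K →ₐ[ℚ] L) (ιL : L →+* ℂ) (Φ₀ : CMType K)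
    (h2 : Module.finrank ℚ (reflexField ℚ L (algValuedIn ιL Φ₀.1)) = 2)
    (hfac : (Module.finrank ℚ K / 2).factorial ∣ Module.finrank ℚ L) (h3 : 6 ≤ Module.finrank ℚ K) {Φ : CMType K}
    {φ₀ : K →+* ℂ} (hP : IsPrimitive (ℂ ≃+* ℂ) Φ.1 φ₀) : Module.finrank ℚ K / 2 ≤ cmTypeRank Φ := by
  by_cases hw : 2 * (Φ₀.1 \ Φ.1).ncard = Module.finrank ℚ K / 2
  · rw [cmTypeRank_eq_of_factorial_dvd_of_balanced j ιL Φ₀ Φ h2 hfac h3 hw]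
  · have h1 := (isNondegenerate_iff_of_isPrimitive_of_factorial_dvd j ιL Φ₀ Φ h2 hfac h3 hP).2 hw
    rw [isNondegenerate_iff] at h1
    omega

end TypeLevel

/-! ### §2 Realisations: the Hodge conjecture -/

section Geometry

variable {Φ : CMType K} {A : AbelianVariety ℂ} {ι : 𝓞 K →+* End A} {θ : K →+* Module.End ℂ (complexBetti A.X 1)}

/-- **`n` ODD ⟹ `Bᵐ(Aʳ) ⊗ ℂ = Dᵐ(Aʳ) ⊗ ℂ` for every power of every realisation of a primitive type** (no exceptional
Hodge classes anywhere; Prop. 2.1 + White–Hazama). [cite: Dodson1987, Prop. 2.1] [cite: Gordon1999HodgeAVSurvey, Thm. 6.4 and §9.3] -/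
theorem hodgeClassSpan_pow_eq_divisorClassesSpan_of_odd (j : K →ₐ[ℚ] L) (ιL : L →+* ℂ) (Φ₀ : CMType K)
    (h2 : Module.finrank ℚ (reflexField ℚ L (algValuedIn ιL Φ₀.1)) = 2)
    (hfac : (Module.finrank ℚ K / 2).factorial ∣ Module.finrank ℚ L) (h3 : 6 ≤ Module.finrank ℚ K)
    (hodd : Odd (Module.finrank ℚ K / 2)) {φ₀ : K →+* ℂ} (hP : IsPrimitive (ℂ ≃+* ℂ) Φ.1 φ₀)
    (hA : IsCMTypeRealisation Φ A ι θ) (r m : ℕ) :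
    hodgeClassSpan (⨁ fun _ : Fin r => A).dim (⨁ fun _ : Fin r => A).X m =
      divisorClassesSpan (⨁ fun _ : Fin r => A).X (⨁ fun _ : Fin r => A).dim m :=
  (isNondegenerate_of_isPrimitive_of_factorial_dvd_of_odd j ιL Φ₀ Φ h2 hfac h3 hodd hP).hodgeClassSpan_pow_eq_divisorClassesSpan
    hA r m

/-- **Dodson 1987 Prop. 2.1 ⟹ the Hodge conjecture for ALL POWERS of every simple CM abelian variety of type `(K, Φ)`,
`Φ` primitive, when `n = dim A` is ODD, `K ⊇ k` imaginary quadratic and `n! ∣ [Kᶜ : ℚ]`** — UNCONDITIONAL.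
[cite: Dodson1987, Prop. 2.1] [cite: Gordon1999HodgeAVSurvey, Thm. 6.4 and §9.3] -/
theorem hodgeConjectureFor_pow_of_odd (j : K →ₐ[ℚ] L) (ιL : L →+* ℂ) (Φ₀ : CMType K)
    (h2 : Module.finrank ℚ (reflexField ℚ L (algValuedIn ιL Φ₀.1)) = 2)
    (hfac : (Module.finrank ℚ K / 2).factorial ∣ Module.finrank ℚ L) (h3 : 6 ≤ Module.finrank ℚ K)
    (hodd : Odd (Module.finrank ℚ K / 2)) {φ₀ : K →+* ℂ} (hP : IsPrimitive (ℂ ≃+* ℂ) Φ.1 φ₀)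
    (hA : IsCMTypeRealisation Φ A ι θ) (r : ℕ) :
    HodgeConjectureFor (⨁ fun _ : Fin r => A).dim (⨁ fun _ : Fin r => A).X :=
  (isNondegenerate_of_isPrimitive_of_factorial_dvd_of_odd j ιL Φ₀ Φ h2 hfac h3 hodd hP).hodgeConjectureFor_pow hA r

/-- … and for `A` itself. [cite: Dodson1987, Prop. 2.1] [cite: Gordon1999HodgeAVSurvey, §9.3] -/
theorem hodgeConjectureFor_of_odd (j : K →ₐ[ℚ] L) (ιL : L →+* ℂ) (Φ₀ : CMType K)
    (h2 : Module.finrank ℚ (reflexField ℚ L (algValuedIn ιL Φ₀.1)) = 2)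
    (hfac : (Module.finrank ℚ K / 2).factorial ∣ Module.finrank ℚ L) (h3 : 6 ≤ Module.finrank ℚ K)
    (hodd : Odd (Module.finrank ℚ K / 2)) {φ₀ : K →+* ℂ} (hP : IsPrimitive (ℂ ≃+* ℂ) Φ.1 φ₀)
    (hA : IsCMTypeRealisation Φ A ι θ) : HodgeConjectureFor A.dim A.X :=
  (isNondegenerate_of_isPrimitive_of_factorial_dvd_of_odd j ιL Φ₀ Φ h2 hfac h3 hodd hP).hodgeConjectureFor hA

/-- **Any `n`: a primitive type UNBALANCED over `k` (`2|Φ₀ ∖ Φ| ≠ n`) gives the Hodge conjecture for all powers.**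
[cite: Dodson1987, Prop. 2.1 (proof)] [cite: Gordon1999HodgeAVSurvey, Thm. 6.4 and §9.3] -/
theorem hodgeConjectureFor_pow_of_two_mul_ne (j : K →ₐ[ℚ] L) (ιL : L →+* ℂ) (Φ₀ : CMType K)
    (h2 : Module.finrank ℚ (reflexField ℚ L (algValuedIn ιL Φ₀.1)) = 2)
    (hfac : (Module.finrank ℚ K / 2).factorial ∣ Module.finrank ℚ L) (h3 : 6 ≤ Module.finrank ℚ K)
    {φ₀ : K →+* ℂ} (hP : IsPrimitive (ℂ ≃+* ℂ) Φ.1 φ₀) (hw : 2 * (Φ₀.1 \ Φ.1).ncard ≠ Module.finrank ℚ K / 2)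
    (hA : IsCMTypeRealisation Φ A ι θ) (r : ℕ) :
    HodgeConjectureFor (⨁ fun _ : Fin r => A).dim (⨁ fun _ : Fin r => A).X :=
  ((isNondegenerate_iff_of_isPrimitive_of_factorial_dvd j ιL Φ₀ Φ h2 hfac h3 hP).2 hw).hodgeConjectureFor_pow hA r

omit [IsCMField K] in
/-- **A primitive type BALANCED over `k` (`2|Φ₀ ∖ Φ| = n`, `n` even) is degenerate** (rank exactly `n`).
[cite: Dodson1984, §3.1.1 Theorem] [cite: Gordon1999HodgeAVSurvey, 9.4] -/
theorem not_isNondegenerate_of_two_mul_eq (j : K →ₐ[ℚ] L) (ιL : L →+* ℂ) (Φ₀ : CMType K)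
    (h2 : Module.finrank ℚ (reflexField ℚ L (algValuedIn ιL Φ₀.1)) = 2)
    (hfac : (Module.finrank ℚ K / 2).factorial ∣ Module.finrank ℚ L) (h3 : 6 ≤ Module.finrank ℚ K)
    (hw : 2 * (Φ₀.1 \ Φ.1).ncard = Module.finrank ℚ K / 2) : ¬ IsNondegenerate Φ :=
  not_isNondegenerate_of_factorial_dvd_of_balanced j ιL Φ₀ Φ h2 hfac h3 hw

/-- **… so some power of every realisation carries an EXCEPTIONAL Hodge class** (a rational `(m,m)`-class outside
`Dᵐ ⊗ ℂ`; by corank one it is a Weil class over `k` in the middle degree of `A` itself, see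
`hodgeConjectureFor_pow_or_weilType`). [cite: Gordon1999HodgeAVSurvey, Thm. 6.4 and 5.13] -/
theorem exists_exceptional_pow_of_two_mul_eq (j : K →ₐ[ℚ] L) (ιL : L →+* ℂ) (Φ₀ : CMType K)
    (h2 : Module.finrank ℚ (reflexField ℚ L (algValuedIn ιL Φ₀.1)) = 2)
    (hfac : (Module.finrank ℚ K / 2).factorial ∣ Module.finrank ℚ L) (h3 : 6 ≤ Module.finrank ℚ K)
    {φ₀ : K →+* ℂ} (hP : IsPrimitive (ℂ ≃+* ℂ) Φ.1 φ₀) (hw : 2 * (Φ₀.1 \ Φ.1).ncard = Module.finrank ℚ K / 2)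
    (hA : IsCMTypeRealisation Φ A ι θ) :
    ∃ r m : ℕ, ∃ c : complexBetti (⨁ fun _ : Fin r => A).X (2 * m), IsRationalClass c ∧
      IsOfHodgeType (⨁ fun _ : Fin r => A).dim (⨁ fun _ : Fin r => A).X (2 * m) m m c ∧
      c ∉ divisorClassesSpan (⨁ fun _ : Fin r => A).X (⨁ fun _ : Fin r => A).dim m :=
  exists_exceptional_pow_of_not_isNondegenerate φ₀ hP (not_isNondegenerate_of_two_mul_eq j ιL Φ₀ h2 hfac h3 hw) hA

/-- **The dichotomy (Gordon 5.13 (i)/(ii)) for EVERY simple CM abelian variety of type `(K, Φ)`, `Φ` primitive, `K ⊇ k`,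
`n! ∣ [Kᶜ : ℚ]`, in every dimension `n ≥ 3`**: either `Φ` is nondegenerate and the Hodge conjecture holds for `A` and
all its powers unconditionally, or `(A, ι √-d)` is of Weil type, its Hodge classes are generated by divisors and ONE
Weil plane, and HC(`A`) follows from the algebraicity of the rational classes of that plane — the tree's
`CorankOne.hodgeConjectureFor_pow_or_weilType` with its hypothesis `hrank` DISCHARGED by `le_cmTypeRank_of_isPrimitive`.
[cite: Gordon1999HodgeAVSurvey, 5.13 and Thm. 6.4 and 9.5] [cite: vanGeemen1994HodgeAV, Thm. 6.12] [cite: Dodson1987, Prop. 2.1] -/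
theorem hodgeConjectureFor_pow_or_weilType (j : K →ₐ[ℚ] L) (ιL : L →+* ℂ) (Φ₀ : CMType K)
    (h2 : Module.finrank ℚ (reflexField ℚ L (algValuedIn ιL Φ₀.1)) = 2)
    (hfac : (Module.finrank ℚ K / 2).factorial ∣ Module.finrank ℚ L) (h3 : 6 ≤ Module.finrank ℚ K)
    {φ₀ : K →+* ℂ} (hP : IsPrimitive (ℂ ≃+* ℂ) Φ.1 φ₀) (hA : IsCMTypeRealisation Φ A ι θ) :
    (IsNondegenerate Φ ∧ HodgeConjectureFor A.dim A.X ∧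
        ∀ r : ℕ, HodgeConjectureFor (⨁ fun _ : Fin r => A).dim (⨁ fun _ : Fin r => A).X) ∨
      ∃ (p : ℕ) (w : 𝓞 K) (d : ℕ), 4 * p = Module.finrank ℚ K ∧ 0 < d ∧ w ^ 2 = -(d : 𝓞 K) ∧
        IsWeilType A (ι w) p d ∧ IsDivisorWeilGenerated A (ι w) p d ∧
        ((∀ c ∈ weilClassesOf A (ι w) p d, IsRationalClass c → IsOfHodgeType (2 * p) A.X (2 * p) p p c →
            c ∈ algebraicClasses A.X p) → HodgeConjectureFor A.dim A.X) :=
  CorankOne.hodgeConjectureFor_pow_or_weilType (le_cmTypeRank_of_isPrimitive j ιL Φ₀ h2 hfac h3 hP) φ₀ hP hA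

/-- **The Hodge conjecture for ALL POWERS of every such simple CM abelian variety, modulo the Weil classes of its own
Weil-type pairs `(A, ι √-d)`** (vacuous when `Φ` is nondegenerate, e.g. `n` odd): the tree's
`CorankOne.hodgeConjectureFor_pow` with `hrank` discharged. [cite: Gordon1999HodgeAVSurvey, 9.5 and Thm. 6.4]
[cite: vanGeemen1994HodgeAV, 1.1] -/
theorem hodgeConjectureFor_pow_of_weilClasses (j : K →ₐ[ℚ] L) (ιL : L →+* ℂ) (Φ₀ : CMType K)
    (h2 : Module.finrank ℚ (reflexField ℚ L (algValuedIn ιL Φ₀.1)) = 2)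
    (hfac : (Module.finrank ℚ K / 2).factorial ∣ Module.finrank ℚ L) (h3 : 6 ≤ Module.finrank ℚ K)
    {φ₀ : K →+* ℂ} (hP : IsPrimitive (ℂ ≃+* ℂ) Φ.1 φ₀) (hA : IsCMTypeRealisation Φ A ι θ)
    (hW : ∀ (p : ℕ) (w : 𝓞 K) (d : ℕ), 0 < d → w ^ 2 = -(d : 𝓞 K) → IsWeilType A (ι w) p d →
      ∀ c ∈ weilClassesOf A (ι w) p d, IsRationalClass c → IsOfHodgeType (2 * p) A.X (2 * p) p p c →
        c ∈ algebraicClasses A.X p) (r : ℕ) :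
    HodgeConjectureFor (⨁ fun _ : Fin r => A).dim (⨁ fun _ : Fin r => A).X :=
  CorankOne.hodgeConjectureFor_pow (le_cmTypeRank_of_isPrimitive j ιL Φ₀ h2 hfac h3 hP) φ₀ hP hA hW r

/-- **… modulo the imaginary-quadratic rung of the Weil-type ladder in dimension `n = 2p`** (every pair `(A', φ')` of
Weil type `(p, d)` has algebraic Weil classes — Markman 2025 for `p = 2`): HC for every power.
[cite: vanGeemen1994HodgeAV, 1.1 and Thm. 6.12] [cite: Gordon1999HodgeAVSurvey, 9.5] -/
theorem hodgeConjectureFor_pow_of_weilClassesImaginaryQuadratic (j : K →ₐ[ℚ] L) (ιL : L →+* ℂ) (Φ₀ : CMType K)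
    (h2 : Module.finrank ℚ (reflexField ℚ L (algValuedIn ιL Φ₀.1)) = 2)
    (hfac : (Module.finrank ℚ K / 2).factorial ∣ Module.finrank ℚ L) (h3 : 6 ≤ Module.finrank ℚ K)
    {φ₀ : K →+* ℂ} (hP : IsPrimitive (ℂ ≃+* ℂ) Φ.1 φ₀) (hA : IsCMTypeRealisation Φ A ι θ) {p : ℕ}
    (hp4 : 4 * p = Module.finrank ℚ K)
    (hW : ∀ (d : ℕ), 0 < d → ∀ (A' : AbelianVariety ℂ) (φ' : A' ⟶ A'), IsWeilType A' φ' p d →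
      ∀ c ∈ weilClassesOf A' φ' p d, IsRationalClass c → IsOfHodgeType (2 * p) A'.X (2 * p) p p c →
        c ∈ algebraicClasses A'.X p) (r : ℕ) :
    HodgeConjectureFor (⨁ fun _ : Fin r => A).dim (⨁ fun _ : Fin r => A).X :=
  CorankOne.hodgeConjectureFor_pow_of_weilClassesImaginaryQuadratic (le_cmTypeRank_of_isPrimitive j ιL Φ₀ h2 hfac h3 hP)
    φ₀ hP hA hp4 hW r

end Geometry

/-! ### §3 Over an explicit imaginary quadratic subfield `k : k₀ →+* K` -/

section ImaginaryQuadratic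

variable {k₀ : Type} [Field k₀] [NumberField k₀] [IsTotallyComplex k₀]
variable {Φ : CMType K} {A : AbelianVariety ℂ} {ι : 𝓞 K →+* End A} {θ : K →+* Module.End ℂ (complexBetti A.X 1)}

omit [IsCMField K] in
/-- Corank `≤ 1` for every primitive type of a CM field containing the imaginary quadratic field `k₀`, `n! ∣ [Kᶜ : ℚ]`,
`n ≥ 3`. [cite: Dodson1987, Prop. 2.1 (proof)] -/
theorem le_cmTypeRank_of_isPrimitive_of_ringHom (h2 : Module.finrank ℚ k₀ = 2) (k : k₀ →+* K) (j : K →ₐ[ℚ] L)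
    (ιL : L →+* ℂ) (hfac : (Module.finrank ℚ K / 2).factorial ∣ Module.finrank ℚ L) (h3 : 6 ≤ Module.finrank ℚ K)
    {φ₀ : K →+* ℂ} (hP : IsPrimitive (ℂ ≃+* ℂ) Φ.1 φ₀) : Module.finrank ℚ K / 2 ≤ cmTypeRank Φ :=
  le_cmTypeRank_of_isPrimitive j ιL _ (finrank_reflexField_algValuedIn_inducedCMType_single h2 k j ιL (φ₀.comp k))
    hfac h3 hP

/-- **Dodson 1987 Prop. 2.1 for abelian varieties: `K ⊇ k₀` imaginary quadratic, `n = dim A` odd, `n! ∣ [Kᶜ : ℚ]` ⟹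
the Hodge conjecture for every power of every simple CM abelian variety of type `(K, Φ)`, `Φ` primitive** — unconditional.
[cite: Dodson1987, Prop. 2.1] [cite: Gordon1999HodgeAVSurvey, Thm. 6.4 and §9.3] -/
theorem hodgeConjectureFor_pow_of_ringHom_of_odd (h2 : Module.finrank ℚ k₀ = 2) (k : k₀ →+* K) (j : K →ₐ[ℚ] L)
    (ιL : L →+* ℂ) (hfac : (Module.finrank ℚ K / 2).factorial ∣ Module.finrank ℚ L) (h3 : 6 ≤ Module.finrank ℚ K)
    (hodd : Odd (Module.finrank ℚ K / 2)) {φ₀ : K →+* ℂ} (hP : IsPrimitive (ℂ ≃+* ℂ) Φ.1 φ₀)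
    (hA : IsCMTypeRealisation Φ A ι θ) (r : ℕ) :
    HodgeConjectureFor (⨁ fun _ : Fin r => A).dim (⨁ fun _ : Fin r => A).X :=
  (isNondegenerate_of_isPrimitive_of_ringHom_of_odd h2 k j ιL Φ hfac h3 hodd hP).hodgeConjectureFor_pow hA r

/-- … and for `A` itself. [cite: Dodson1987, Prop. 2.1] [cite: Gordon1999HodgeAVSurvey, §9.3] -/
theorem hodgeConjectureFor_of_ringHom_of_odd (h2 : Module.finrank ℚ k₀ = 2) (k : k₀ →+* K) (j : K →ₐ[ℚ] L)
    (ιL : L →+* ℂ) (hfac : (Module.finrank ℚ K / 2).factorial ∣ Module.finrank ℚ L) (h3 : 6 ≤ Module.finrank ℚ K)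
    (hodd : Odd (Module.finrank ℚ K / 2)) {φ₀ : K →+* ℂ} (hP : IsPrimitive (ℂ ≃+* ℂ) Φ.1 φ₀)
    (hA : IsCMTypeRealisation Φ A ι θ) : HodgeConjectureFor A.dim A.X :=
  (isNondegenerate_of_isPrimitive_of_ringHom_of_odd h2 k j ιL Φ hfac h3 hodd hP).hodgeConjectureFor hA

/-- The dichotomy over an explicit imaginary quadratic `k₀ ↪ K` (any `n ≥ 3`).
[cite: Gordon1999HodgeAVSurvey, 5.13 and Thm. 6.4 and 9.5] [cite: Dodson1987, Prop. 2.1] -/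
theorem hodgeConjectureFor_pow_or_weilType_of_ringHom (h2 : Module.finrank ℚ k₀ = 2) (k : k₀ →+* K)
    (j : K →ₐ[ℚ] L) (ιL : L →+* ℂ) (hfac : (Module.finrank ℚ K / 2).factorial ∣ Module.finrank ℚ L)
    (h3 : 6 ≤ Module.finrank ℚ K) {φ₀ : K →+* ℂ} (hP : IsPrimitive (ℂ ≃+* ℂ) Φ.1 φ₀) (hA : IsCMTypeRealisation Φ A ι θ) :
    (IsNondegenerate Φ ∧ HodgeConjectureFor A.dim A.X ∧
        ∀ r : ℕ, HodgeConjectureFor (⨁ fun _ : Fin r => A).dim (⨁ fun _ : Fin r => A).X) ∨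
      ∃ (p : ℕ) (w : 𝓞 K) (d : ℕ), 4 * p = Module.finrank ℚ K ∧ 0 < d ∧ w ^ 2 = -(d : 𝓞 K) ∧
        IsWeilType A (ι w) p d ∧ IsDivisorWeilGenerated A (ι w) p d ∧
        ((∀ c ∈ weilClassesOf A (ι w) p d, IsRationalClass c → IsOfHodgeType (2 * p) A.X (2 * p) p p c →
            c ∈ algebraicClasses A.X p) → HodgeConjectureFor A.dim A.X) :=
  CorankOne.hodgeConjectureFor_pow_or_weilType (le_cmTypeRank_of_isPrimitive_of_ringHom h2 k j ιL hfac h3 hP) φ₀ hP hA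

end ImaginaryQuadratic

/-! ### §4 Proposition 2.1 as printed: the hypothesis on `Gal(K₀ᶜ/ℚ)` only -/

section AsPrinted

variable {Φ : CMType K} {A : AbelianVariety ℂ} {ι : 𝓞 K →+* End A} {θ : K →+* Module.End ℂ (complexBetti A.X 1)}

omit [IsGalois ℚ L] in
/-- **Dodson 1987, Prop. 2.1 ⟹ the Hodge conjecture for ALL POWERS of every simple CM abelian variety `A` of ODD
dimension `n ≥ 3` whose CM field `K` has `Gal(K₀ᶜ/ℚ) ≅ Aₙ` or `Sₙ`** (`K₀` the maximal totally real subfield,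
`K₀ᶜ = normalClosure ℚ K₀ L` in a normal closure `L` of `K`, the hypothesis read as `n!/2 ∣ [K₀ᶜ : ℚ]`; `Φ` primitive =
`A` simple) — UNCONDITIONAL: every such type is nondegenerate, and nondegenerate ⟹ `Hdg(Aʳ) = Div(Aʳ)` for all `r`
(Hazama–Murty). [cite: Dodson1987, Prop. 2.1] [cite: Gordon1999HodgeAVSurvey, Thm. 6.4 and §9.3] -/
theorem hodgeConjectureFor_pow_of_factorial_dvd_finrank_normalClosure_of_odd
    (hG : (Module.finrank ℚ K / 2).factorial ∣
      2 * Module.finrank ℚ (IntermediateField.normalClosure ℚ (maximalRealSubfield K) L))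
    (h3 : 6 ≤ Module.finrank ℚ K) (hodd : Odd (Module.finrank ℚ K / 2)) {φ₀ : K →+* ℂ}
    (hP : IsPrimitive (ℂ ≃+* ℂ) Φ.1 φ₀) (hA : IsCMTypeRealisation Φ A ι θ) (r : ℕ) :
    HodgeConjectureFor (⨁ fun _ : Fin r => A).dim (⨁ fun _ : Fin r => A).X :=
  (isNondegenerate_of_isPrimitive_of_factorial_dvd_finrank_normalClosure_of_odd (L := L) Φ hG h3 hodd
    hP).hodgeConjectureFor_pow hA r

omit [IsGalois ℚ L] in
/-- … and for `A` itself. [cite: Dodson1987, Prop. 2.1] [cite: Gordon1999HodgeAVSurvey, §9.3] -/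
theorem hodgeConjectureFor_of_factorial_dvd_finrank_normalClosure_of_odd
    (hG : (Module.finrank ℚ K / 2).factorial ∣
      2 * Module.finrank ℚ (IntermediateField.normalClosure ℚ (maximalRealSubfield K) L))
    (h3 : 6 ≤ Module.finrank ℚ K) (hodd : Odd (Module.finrank ℚ K / 2)) {φ₀ : K →+* ℂ}
    (hP : IsPrimitive (ℂ ≃+* ℂ) Φ.1 φ₀) (hA : IsCMTypeRealisation Φ A ι θ) : HodgeConjectureFor A.dim A.X :=
  (isNondegenerate_of_isPrimitive_of_factorial_dvd_finrank_normalClosure_of_odd (L := L) Φ hG h3 hodd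
    hP).hodgeConjectureFor hA

omit [IsGalois ℚ L] in
/-- … with no exceptional Hodge classes on any power: `Bᵐ(Aʳ) ⊗ ℂ = Dᵐ(Aʳ) ⊗ ℂ`.
[cite: Dodson1987, Prop. 2.1] [cite: Gordon1999HodgeAVSurvey, Thm. 6.4] -/
theorem hodgeClassSpan_pow_eq_divisorClassesSpan_of_factorial_dvd_finrank_normalClosure_of_odd
    (hG : (Module.finrank ℚ K / 2).factorial ∣
      2 * Module.finrank ℚ (IntermediateField.normalClosure ℚ (maximalRealSubfield K) L))
    (h3 : 6 ≤ Module.finrank ℚ K) (hodd : Odd (Module.finrank ℚ K / 2)) {φ₀ : K →+* ℂ}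
    (hP : IsPrimitive (ℂ ≃+* ℂ) Φ.1 φ₀) (hA : IsCMTypeRealisation Φ A ι θ) (r m : ℕ) :
    hodgeClassSpan (⨁ fun _ : Fin r => A).dim (⨁ fun _ : Fin r => A).X m =
      divisorClassesSpan (⨁ fun _ : Fin r => A).X (⨁ fun _ : Fin r => A).dim m :=
  (isNondegenerate_of_isPrimitive_of_factorial_dvd_finrank_normalClosure_of_odd (L := L) Φ hG h3 hodd
    hP).hodgeClassSpan_pow_eq_divisorClassesSpan hA r m

end AsPrinted

end AlternatingRealField

end Literature.AlgebraicGeometry.Pohlmann1968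

end
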